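import Mathlib
import Summits.MatrixMultiplication.MatrixMultiplication.Theses.HiddenToeplitzCorners

/-! Sketch for the crux idea card `toeplitz-cycle-cover-designs` (stmt-MatrixMultiplication-7492): first-lemma signatures. -/

set_option linter.dupNamespace false

namespace Summit.MatrixMultiplication.MatrixMultiplication.Cruxes.HiddenCorners.CycleCoverSketch

open scoped BigOperators Matrix
open Summit.MatrixMultiplication.MatrixMultiplication.Theses.HiddenToeplitzCorners

/-- The honest Toeplitz pencil of a two-sided symbol placement `W : ℤ → (M_r →ₗ ℂ)`: entry `(i,j) ↦ W (i - j) X`. -/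
def toeplitzPencil (r N : ℕ) (W : ℤ → (Matrix (Fin r) (Fin r) ℂ →ₗ[ℂ] ℂ)) (X : Matrix (Fin r) (Fin r) ℂ) :
    Matrix (Fin N) (Fin N) ℂ :=
  Matrix.of fun i j : Fin N => W ((i : ℤ) - (j : ℤ)) X

/-- PURE-POWER DESIGN at `(r, N)`: an honest Toeplitz pencil of size `N` on `M_r` with `det = c · (det X)^(N/r)`, `c ≠ 0`
(the two-sided rigid form S⁺₁₁ of the gen-4 census; the `r = 2` PoC is `PurePowerDesign 2 4`). -/
def PurePowerDesign (r N : ℕ) : Prop :=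
  ∃ (W : ℤ → (Matrix (Fin r) (Fin r) ℂ →ₗ[ℂ] ℂ)) (c : ℂ), c ≠ 0 ∧
    ∀ X : Matrix (Fin r) (Fin r) ℂ, (toeplitzPencil r N W X).det = c * X.det ^ (N / r)

/-- First lemma (rung, provable from the landed `toeplitzCornerTwo_proof`): the PoC is a pure-power design. -/
theorem purePower_two_four : PurePowerDesign 2 4 := by
  sorry

/-- The cheapest decisive instance of the open two-sided core (census R3(a)): is `(det X)³` a `9 × 9` Toeplitz determinant of
linear forms?  Finite algebra; either answer is informative. -/
def PurePowerThreeNine : Prop := PurePowerDesign 3 9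

/-- CYCLE-COVER DESIGNS feed the crux (transfer stub shape; the sparsity clause of the crux — number of nonzero diagonals per
variable `≤ r^ε` on average — is bookkeeping on `W` and omitted in this sketch): a budgeted pure-power family gives `HiddenCorners`
(honest ⇒ split width 1 with `G₀ = H₀ = e₀`; nonsingular at `X = 1`; singular on `det X = 0` since `N/r ≥ 1`). -/
theorem hiddenCorners_of_purePower
    (h : ∀ ε : ℝ, 0 < ε → ∃ᶠ r : ℕ in Filter.atTop, ∃ N : ℕ, r ≤ N ∧ (N : ℝ) ≤ (r : ℝ) ^ (2 + ε) ∧ PurePowerDesign r N)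
    (hsparse : True) : HiddenCorners := by
  sorry

end Summit.MatrixMultiplication.MatrixMultiplication.Cruxes.HiddenCorners.CycleCoverSketch
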